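import Mathlib.Data.List.Dedup
import Mathlib.Data.ZMod.Basic
import Literature.Computability.Complexity.PolynomialEntropyApproximation
import Literature.Computability.Complexity.BlockTuples
import Literature.Computability.Complexity.SipserCodingLemma
import HarnessLib

/-!
# Entropy approximation for explicit maps over `F₂` in `Σ₂ᵖ`: the hashing program

Topic `Computability/Complexity` (approximate counting / statistical zero knowledge).  First file of
the proof that the promise problem `PEA d` of Dvir–Gutfreund–Rothblum–Vadhan
(`PolynomialEntropyApproximation.lean`: is the Shannon entropy of `p(U_n)` for a sparse polynomial
map `p : F₂ⁿ → F₂^m` at least `k + 1`, or at most `k`?) lies in `promiseLift (SigmaP 2)` — the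
level of the polynomial hierarchy where approximate counting lives (Sipser 1983, Stockmeyer 1985)
and where the general Entropy Approximation problem of Goldreich–Sahai–Vadhan sits through
`NISZK ⊆ AM ∩ coAM` (Goldreich–Sahai–Vadhan 1999).  The proof is a direct, deterministic rendering
of that upper bound by Sipser's Coding Lemma, with no interaction and no randomness:

* sample `T` independent points `x⃗ = (x₁,…,x_T)` of the domain; `log₂ |fibre(x⃗)| = Σᵢ log₂ |fibre(xᵢ)|`
  concentrates at `T · (n - H)` within `T/4` (Chebyshev), so on a YES instance almost every `x⃗` has a
  SMALL product fibre and on a NO instance almost every `x⃗` has a LARGE one;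
* cap fibre sizes with one affine hash `(A, b)` of `r` rows: the set
  `S = {(x⃗, A, b) | ∃ x⃗' ∈ fibre(x⃗), A x⃗' = b}` — an `NP`-type set — occupies at most a quarter of
  its ambient cube on YES instances and at least three quarters on NO instances (union bound, resp.
  pairwise independence of affine hashing);
* by Sipser's Coding Lemma (tree: `hashable_tuplePow_of_small` / `not_hashable_tuplePow_of_large`)
  the `t`-fold power of `S` is separable by `t(M-1)` linear hash matrices exactly in the first case, and
  "some family of matrices separates `S^t`" is a `Σ₂ᵖ` statement whose matrix — Sipser's skolemised
  `Separate` predicate with the `NP`-witnesses of NON-membership in `S` quantified universally — is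
  decided by the polynomial-time PROGRAM `PEAHash.matP` of this file.

Because the number of variables `n` of a `PEA` instance is written in binary (it may be exponential
in the length of the instance), the program first RENAMES the variables that actually occur in the
sparse map to `0, …, n' - 1` (`usedVars`, `rename`; the output distribution, hence the entropy, is
unchanged), and all parameters are polynomials in `n'`.

## Contents (definitions only; the analysis is in the sibling files `PEASigmaTwo*.lean`)

* `PEAHash.Shadow`, `PEAHash.erase` — instances with the `Fin n` indices erased to `ℕ` (the typed
  `FP` algebra `CodeFP` works over non-dependent data; the Boolean code is unchanged);
* `usedVars`, `nVars`, `rename`; `evalMono`, `evalPoly`, `evalMap` — evaluation of a sparse map at a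
  point given as a list of bits;
* the parameters `pT = 128 n'²` (samples), `pN = T·n'` (bits of `x⃗`), `pR = T(n'-k) - T/2` (hash rows),
  `pM = N + (rN + r)` (bits of a member `(x⃗, A, b)` of `S`), `pt = M + 5` (Sipser power), `pL = t·M`
  (bits of a member of `S^t`), `pK = t(M-1)` (hash level = number and format of the separating matrices);
* `sliceD`, `dotB`, `fibOK`, `hashOK`, `relOK` (the `P`-relation "`x⃗'` witnesses `(x⃗, A, b) ∈ S`"),
  `notInX`, `matCore`, **`matP`** (the matrix of the `Σ₂ᵖ` predicate on a frame `(instance, h, v, u)`: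
  `h` = the matrices, `v` = a candidate member `y` of `S^t` and one challenger `Z_a` per matrix,
  `u` = purported membership witnesses for every block of `y` and of every `Z_a`);
* the combinatorial side used by the analysis: `vget`, `vslice`, `evalV`, `fib`, **`npSet`** (`S` as a
  `Finset (Fin M → Bool)`).

## Design notes

* `evalMono/evalPoly/evalMap`, `sliceD`, `dotB` are LIST-level mirrors of `PolyMapF2.eval` (typed
  indices `Fin n`, values in `ZMod 2`), of the window reads of `PostBPPHashLanguage.lean` and of
  `SipserHash.dotZ`: the matrix must be ONE functional program on codes and raw strings, to which the
  typed `FP` algebra `CodeFP` applies verbatim (`PEASigmaTwoFP.lean`); the identification with the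
  typed objects (`evalV`, `fib`, `npSet`, `SipserHash.Hashable (tuplePow npSet t) κ`) is proved in the
  sibling files, not assumed.
* Every string decodes (windows past the end read `0`), so the quantified strings `h, v, u` of the
  `Σ₂ᵖ` predicate range over ALL strings of bounded length, as `polyExists`/`polyForall` require.
* `pN`, `pL` are `abbrev`s (products `T·n'`, `t·M`) so that block vectors `Fin (T * n') → Bool`,
  `Fin (t * M) → Bool` unify with `Blocks.blk` / `PostBPPHash.tuplePow` without rewriting.

## References

* M. Sipser, *A complexity theoretic approach to randomness*, STOC 1983, §III (Coding Lemma), §V.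
* L. Stockmeyer, *On approximation algorithms for #P*, SIAM J. Comput. 14 (1985), Thm 3.1.
* O. Goldreich, A. Sahai, S. Vadhan, *Can statistical zero knowledge be made non-interactive?*,
  CRYPTO 1999 (Entropy Approximation; `NISZK ⊆ AM ∩ coAM`).
* Z. Dvir, D. Gutfreund, G. N. Rothblum, S. Vadhan, *On approximating the entropy of polynomial
  mappings*, ICS 2011 / ECCC TR10-160, §3 (the problems `PEA`, `PED`).
* S. Arora, B. Barak, *Computational Complexity: A Modern Approach*, CUP 2009, Def. 5.3, §1.3.
-/

namespace Literature.Computability.Complexity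

open _root_.Computability Finset Blocks SipserHash

namespace PEAHash

/-! ### Erased instances -/

/-- Instances of `PEA` with the variable indices erased from `Fin n` to `ℕ`: `(n, p, k)` with `p` a
list of output polynomials, each a list of monomials, each a list of variable indices.  The Boolean
code of an instance only depends on its erasure (indices are written in binary). [folklore] -/
abbrev Shadow : Type := ℕ × (List (List (List ℕ)) × ℕ)

/-- The erasure of a `PEA` instance. [folklore] -/
def erase (I : PEAInst) : Shadow :=
  (I.1, (I.2.1.map (List.map (List.map Fin.val)), I.2.2))

/-! ### Renaming the occurring variables -/

/-- The variable indices occurring in a sparse map, without repetition. [folklore] -/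
def usedVars (P : List (List (List ℕ))) : List ℕ := P.flatten.flatten.dedup

/-- The number `n'` of occurring variables (at most the length of the code of the map). [folklore] -/
def nVars (P : List (List (List ℕ))) : ℕ := (usedVars P).length

/-- The map with its variables renamed to `0, …, n' - 1` (an index is replaced by its position in
`usedVars`).  Evaluating the renamed map at `x ∘ ι`, `ι` the enumeration of the used variables, gives
the value of the original map at `x`, so the output distribution on a uniform input — and its
entropy — is unchanged. [cite: DvirGutfreundRothblumVadhan2010, §3 p.6] -/
def rename (P : List (List (List ℕ))) : List (List (List ℕ)) :=
  P.map (List.map (List.map fun i => (usedVars P).idxOf i))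

/-! ### Evaluation at a point given as a list of bits -/

/-- Value of a monomial (product over `F₂` of the listed coordinates = conjunction of bits; missing
coordinates read `0`). [cite: DvirGutfreundRothblumVadhan2010, §2] -/
def evalMono (xs : List Bool) (μ : List ℕ) : Bool := μ.all fun i => xs.getD i false

/-- Value of a polynomial (sum over `F₂` of its monomials = exclusive or). [cite: DvirGutfreundRothblumVadhan2010, §2] -/
def evalPoly (xs : List Bool) (q : List (List ℕ)) : Bool :=
  q.foldl (fun acc μ => (acc ^^ evalMono xs μ)) false

/-- Value of a sparse map: the list of the values of its output polynomials. [cite: DvirGutfreundRothblumVadhan2010, §2] -/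
def evalMap (Q : List (List (List ℕ))) (xs : List Bool) : List Bool := Q.map (evalPoly xs)

/-! ### Parameters (polynomials in the number `n'` of used variables and the threshold `k`) -/

/-- Number of sample points `T = 128 n'²` (Chebyshev: the sum of `T` independent copies of
`log₂ |fibre| ∈ [0, n']` leaves the window `T·mean ± T/4` with probability `≤ 16 n'²/T = 1/8`). [folklore] -/
def pT (n' : ℕ) : ℕ := 128 * n' ^ 2

/-- Number of bits of a sample tuple `x⃗ ∈ (F₂^{n'})^T`: `N = T · n'`. [folklore] -/
abbrev pN (n' : ℕ) : ℕ := pT n' * n'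

/-- Number of rows of the affine hash: `r = T(n' - k) - T/2`, a quarter of `T` above the typical
log-fibre-size `T(n' - k - 1) + T/4` of a YES instance and a quarter below the typical `T(n'-k) - T/4`
of a NO instance (meaningful for `k < n'`). [cite: Sipser1983, §III] -/
def pR (n' k : ℕ) : ℕ := pT n' * (n' - k) - pT n' / 2

/-- Number of bits of a member `(x⃗, A, b)` of the hashed set `S`: `M = N + (r·N + r)`. [folklore] -/
def pM (n' k : ℕ) : ℕ := pN n' + (pR n' k * pN n' + pR n' k)

/-- Sipser's power `t = M + 5` (`PostBPPHash.runs M`). [cite: Sipser1983, §V] -/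
def pt (n' k : ℕ) : ℕ := pM n' k + 5

/-- Number of bits of a member of `S^t`: `L = t · M`. [folklore] -/
abbrev pL (n' k : ℕ) : ℕ := pt n' k * pM n' k

/-- The hash level `κ = t(M - 1)`: `S^t` is to be separated by `κ` matrices of format `κ × L`.
[cite: Sipser1983, §III] -/
def pK (n' k : ℕ) : ℕ := pt n' k * (pM n' k - 1)

/-! ### The polynomial-time relation and the matrix -/

/-- The zero-padded window of length `len` at offset `off` of a bit string. [folklore] -/
def sliceD (s : List Bool) (off len : ℕ) : List Bool := (s.drop off).takeD len false

/-- `F₂` inner product of two bit strings (parity of the coordinatewise conjunction; the shorter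
string is padded with `0`). [cite: HanHemaspaandraThierauf1997, Def. 3.8] -/
def dotB (a w : List Bool) : Bool := (List.zipWith (fun b c => b && c) a w).foldl (fun acc b => (acc ^^ b)) false

/-- `x⃗' ∈ fibre(x⃗)`: the `T` blocks of `n'` bits of the witness `wv` and of `xv` have the same values
under the map `Q`. [cite: DvirGutfreundRothblumVadhan2010, §3 p.6] -/
def fibOK (Q : List (List (List ℕ))) (n' T : ℕ) (xv wv : List Bool) : Bool :=
  (List.range T).all fun i => evalMap Q (sliceD wv (i * n') n') == evalMap Q (sliceD xv (i * n') n')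

/-- `A x⃗' = b` for the affine hash `(A, b)` stored after the first `N` bits of `sv` (row `ρ` of `A` at
offset `N + ρN`, bit `ρ` of `b` at offset `N + rN + ρ`). [cite: Sipser1983, §III] -/
def hashOK (N r : ℕ) (sv wv : List Bool) : Bool :=
  (List.range r).all fun ρ => dotB (sliceD sv (N + ρ * N) N) wv == sv.getD (N + r * N + ρ) false

/-- **The `P`-relation of the `NP`-set `S`**: `wv` witnesses that the `M`-bit string `sv = (x⃗, A, b)`
lies in `S`, i.e. `wv ∈ fibre(x⃗)` and `A wv = b`. [cite: Sipser1983, §III] -/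
def relOK (Q : List (List (List ℕ))) (n' T N r : ℕ) (sv wv : List Bool) : Bool :=
  fibOK Q n' T (sliceD sv 0 N) wv && hashOK N r sv wv

/-- Refutation of membership in `S^t` read off the witness string `u`: some block `j < t` of the
`L`-bit vector `side` is not witnessed by the witness stored for (side number `c`, block `j`) at
offset `(c·t + j)·N` of `u`.  Universally quantified over `u` this says `side ∉ S^t`. [cite: Sipser1983, §V] -/
def notInX (Q : List (List (List ℕ))) (n' T N r M t : ℕ) (side u : List Bool) (c : ℕ) : Bool :=
  (List.range t).any fun j => !relOK Q n' T N r (sliceD side (j * M) M) (sliceD u ((c * t + j) * N) N)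

/-- **The matrix of the `Σ₂ᵖ` predicate** for the renamed map `Q` on `n'` variables and threshold
`k`, on the strings `h` (the `κ` matrices: row `ρ` of matrix `a` is the window at offset `(aκ + ρ)L`),
`v` (the candidate `y` at offset `0` and the challenger `Z_a` at offset `(a+1)L`) and `u` (witnesses):
`k < n'`, and — Sipser's skolemised `Separate` — if `y ∈ S^t` (not refuted by `u`) then some matrix
`a < κ` tells `y` apart from `Z_a` whenever `Z_a ∈ S^t` (not refuted) and `Z_a ≠ y`.
[cite: Sipser1983, §V] [cite: HanHemaspaandraThierauf1997, Thm. 3.11 (proof)] -/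
def matCore (Q : List (List (List ℕ))) (n' k : ℕ) (h v u : List Bool) : Bool :=
  decide (k < n') &&
    (notInX Q n' (pT n') (pN n') (pR n' k) (pM n' k) (pt n' k) (sliceD v 0 (pL n' k)) u 0 ||
      (List.range (pK n' k)).any fun a =>
        notInX Q n' (pT n') (pN n') (pR n' k) (pM n' k) (pt n' k)
            (sliceD v ((a + 1) * pL n' k) (pL n' k)) u (a + 1) ||
          (sliceD v ((a + 1) * pL n' k) (pL n' k) == sliceD v 0 (pL n' k)) ||
          (List.range (pK n' k)).any fun ρ =>
            dotB (sliceD h ((a * pK n' k + ρ) * pL n' k) (pL n' k)) (sliceD v ((a + 1) * pL n' k) (pL n' k)) !=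
              dotB (sliceD h ((a * pK n' k + ρ) * pL n' k) (pL n' k)) (sliceD v 0 (pL n' k)))

/-- **The program**: the matrix on an erased instance `(n, p, k)` and the three quantified strings
(the number `n` of declared variables is not used — only the occurring ones matter). [cite: Sipser1983, §V] -/
def matP (s : Shadow) (h v u : List Bool) : Bool :=
  matCore (rename s.2.1) (nVars s.2.1) s.2.2 h v u

/-! ### The combinatorial side: points, fibres and the hashed set `S` -/

variable {m : ℕ}

/-- Bit `i` of a Boolean vector, `0` past the end. [folklore] -/
def vget (s : Fin m → Bool) (i : ℕ) : Bool := if h : i < m then s ⟨i, h⟩ else false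

/-- The zero-padded window of length `len` at offset `off` of a Boolean vector. [folklore] -/
def vslice (s : Fin m → Bool) (off len : ℕ) : Fin len → Bool := fun c => vget s (off + c)

/-- Value of the map `Q` on `n'` variables at a point of `F₂^{n'}` given as a Boolean vector. [cite: DvirGutfreundRothblumVadhan2010, §2] -/
def evalV (Q : List (List (List ℕ))) (n' : ℕ) (x : Fin n' → Bool) : List Bool := evalMap Q (List.ofFn x)

/-- The fibre of the map through the point `x`: the points with the same value. [cite: DvirGutfreundRothblumVadhan2010, §2] -/
def fib (Q : List (List (List ℕ))) (n' : ℕ) (x : Fin n' → Bool) : Finset (Fin n' → Bool) :=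
  univ.filter fun x' => evalV Q n' x' = evalV Q n' x

/-- **The hashed set `S ⊆ {0,1}^M`** of the criterion: the vectors `(x⃗, A, b)` (`x⃗` the first `N`
bits in `T` blocks of `n'`, row `ρ < r` of `A` the `N` bits at offset `N + ρN`, bit `ρ` of `b` at
`N + rN + ρ`) such that SOME `x⃗'` with the same values as `x⃗` blockwise hashes to `b`:
`∃ x⃗', (∀ i, Q(x⃗'ᵢ) = Q(x⃗ᵢ)) ∧ A x⃗' = b`.  Its `t`-fold power is hashable at level `κ` on YES
instances and not on NO instances (`PEASigmaTwoHashing.lean`). [cite: Sipser1983, §III] -/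
noncomputable def npSet (Q : List (List (List ℕ))) (n' k : ℕ) : Finset (Fin (pM n' k) → Bool) := by
  classical
  exact univ.filter fun s => ∃ w : Fin (pT n' * n') → Bool,
    (∀ i : Fin (pT n'), evalV Q n' (blk w i) = evalV Q n' (blk (vslice s 0 (pT n' * n')) i)) ∧
    ∀ ρ : Fin (pR n' k), dotZ (vslice s (pN n' + ρ * pN n') (pT n' * n')) w =
      if vget s (pN n' + pR n' k * pN n' + ρ) then 1 else 0

end PEAHash

end Literature.Computability.Complexity
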